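import Summits.Ventures.Crystal3D.Theorems.StickyWulffConstantTextureBuildLayerLateral
import Summits.Ventures.Crystal3D.Theorems.StickyWulffConstantTextureLiminfCubeRigidityLayerSteps
import HarnessLib

/-!
# TB-1 brick L-PROP-3 (one step): DESCEND ONE LAYER AND RE-EXPAND — or exhibit an inclined-twin witness
# (lane T, crux `TextureLiminfV5`, stmt-Ventures-23912; memo HOME/wulff-p2/g25/SLAB-PLATES-g25.md §6)

HONEST FRAMING. Venture `Summits/Ventures/Crystal3D` (cell `crystal3d-full`), route `route-Ventures-StickyWulffConstant`, helper `--supports` the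
law-v5 crux `TextureLiminfV5` (stmt-Ventures-23912).  Pure combination (census-free, standard axioms) of `layerDisc_up` / `layerDisc_down`
('…CubeRigidityLayerSteps') with the local re-expansions of '…TextureBuildLayerLateral'.  No cover is built; F-C1 not moved.

WHY.  The near-wall presentation of a grain is read layer by layer toward the wall (memo §4/§6).  One step of the reading = go to the next layer (the datum
shrinks by `2`) and re-expand it along that layer as far as its shells stay close-packed.  The new layer's type is READ (`layerShell ρ (−τ)`, HCP-type iff
`ρ = −τ`); on an HCP-type layer FCC/HCP arrangements re-expand it, on an FCC-type layer FCC arrangements do, and an HCP-ARRANGED ball met on an FCC-type layer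
is returned as a WITNESS (it lies on an inclined coherent twin plane: a sub-grain boundary, where this tent must stop).

* **`layerDisc_up_reexpand`** — from `LayerDisc V c τ τ' n` (`n ≥ 2`), FCC/HCP arrangements at the neighbours of its balls, and FCC/HCP arrangements at the
  lattice points of the layer above (`c' = c + τ w + h e₃`) out to ℓ¹-radius `N + 1`: a sign `ρ` with EITHER `LayerDisc V c' ρ (−τ) N` OR an inclined-twin
  witness (`ρ ≠ −τ` and an HCP-arranged centre `c' + latPt i j`, `|i| + |j| ≤ N + 1`);
* **`layerDisc_down_reexpand`** — the same downwards (`c' = c + τ' w − h e₃`, shell `layerShell (−τ') ρ'`, HCP-type iff `ρ' = −τ'`).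
-/

noncomputable section

namespace Summit.Ventures.Crystal3D.Theorems.LocalStacking

open Literature.Geometry.DiscreteGeometry Literature.MathematicalPhysics.StatisticalMechanics
open RealInnerProductSpace Summit.Ventures.Crystal3D.L2B

variable {V : Set (EuclideanSpace ℝ (Fin 3))}

/-- **DESCEND (upwards) AND RE-EXPAND, or an inclined-twin witness.**  See the module docstring. -/
theorem layerDisc_up_reexpand (hV : IsUnitBallPacking V) {c : EuclideanSpace ℝ (Fin 3)} {τ τ' : ℝ} (hτ : τ = 1 ∨ τ = -1) {n : ℤ}
    (hn : 2 ≤ n) (hL : LayerDisc V c τ τ' n)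
    (hcp : ∀ i j : ℤ, |i| + |j| ≤ n → ∀ y ∈ kissingShell V (c + latPt i j),
      IsArrangedIn (kissingShell V (c + latPt i j + y)) fccKissingPattern ∨
        IsArrangedIn (kissingShell V (c + latPt i j + y)) hcpKissingPattern)
    (N : ℤ)
    (harr : ∀ i j : ℤ, |i| + |j| ≤ N + 1 → c + (τ • barlowOffset (2 : ℝ) + layerNormal layerSpacing) + latPt i j ∈ V →
      IsArrangedIn (kissingShell V (c + (τ • barlowOffset (2 : ℝ) + layerNormal layerSpacing) + latPt i j)) fccKissingPattern ∨
        IsArrangedIn (kissingShell V (c + (τ • barlowOffset (2 : ℝ) + layerNormal layerSpacing) + latPt i j)) hcpKissingPattern) :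
    ∃ ρ : ℝ, (ρ = 1 ∨ ρ = -1) ∧
      (LayerDisc V (c + (τ • barlowOffset (2 : ℝ) + layerNormal layerSpacing)) ρ (-τ) N ∨
        (ρ ≠ -τ ∧ ∃ i j : ℤ, |i| + |j| ≤ N + 1 ∧ c + (τ • barlowOffset (2 : ℝ) + layerNormal layerSpacing) + latPt i j ∈ V ∧
          IsArrangedIn (kissingShell V (c + (τ • barlowOffset (2 : ℝ) + layerNormal layerSpacing) + latPt i j)) hcpKissingPattern)) := by
  set c' := c + (τ • barlowOffset (2 : ℝ) + layerNormal layerSpacing) with hc'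
  obtain ⟨ρ, hρ, hD⟩ := layerDisc_up hV hτ hL hcp
  have hmτ : (-τ = 1 ∨ -τ = -1) := by rcases hτ with rfl | rfl <;> norm_num
  have h00 := hD 0 0 (by simp; linarith)
  rw [latPt_zero, add_zero] at h00
  obtain ⟨hc'V, hSc'⟩ := h00
  refine ⟨ρ, hρ, ?_⟩
  by_cases htype : ρ = -τ
  · -- HCP-type layer: FCC/HCP arrangements re-expand it
    left
    have hS' : kissingShell V c' = layerShell ρ ρ := by rw [hSc', ← htype]
    have h := layerDisc_hcp_local hV hc'V hρ hS' N harr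
    rw [← htype]
    exact h
  · by_cases hw : ∃ i j : ℤ, |i| + |j| ≤ N + 1 ∧ c' + latPt i j ∈ V ∧ IsArrangedIn (kissingShell V (c' + latPt i j)) hcpKissingPattern
    · exact Or.inr ⟨htype, hw⟩
    · -- FCC-type layer with no HCP-arranged ball in range: FCC arrangements re-expand it
      left
      push Not at hw
      refine layerDisc_fcc_local hV hc'V hρ hmτ hSc' N fun i j hij hm => ?_
      rcases harr i j hij hm with h | h
      · exact h
      · exact absurd h (hw i j hij hm)

/-- **DESCEND (downwards) AND RE-EXPAND, or an inclined-twin witness.** -/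
theorem layerDisc_down_reexpand (hV : IsUnitBallPacking V) {c : EuclideanSpace ℝ (Fin 3)} {τ τ' : ℝ} (hτ' : τ' = 1 ∨ τ' = -1) {n : ℤ}
    (hn : 2 ≤ n) (hL : LayerDisc V c τ τ' n)
    (hcp : ∀ i j : ℤ, |i| + |j| ≤ n → ∀ y ∈ kissingShell V (c + latPt i j),
      IsArrangedIn (kissingShell V (c + latPt i j + y)) fccKissingPattern ∨
        IsArrangedIn (kissingShell V (c + latPt i j + y)) hcpKissingPattern)
    (N : ℤ)
    (harr : ∀ i j : ℤ, |i| + |j| ≤ N + 1 → c + (τ' • barlowOffset (2 : ℝ) - layerNormal layerSpacing) + latPt i j ∈ V →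
      IsArrangedIn (kissingShell V (c + (τ' • barlowOffset (2 : ℝ) - layerNormal layerSpacing) + latPt i j)) fccKissingPattern ∨
        IsArrangedIn (kissingShell V (c + (τ' • barlowOffset (2 : ℝ) - layerNormal layerSpacing) + latPt i j)) hcpKissingPattern) :
    ∃ ρ' : ℝ, (ρ' = 1 ∨ ρ' = -1) ∧
      (LayerDisc V (c + (τ' • barlowOffset (2 : ℝ) - layerNormal layerSpacing)) (-τ') ρ' N ∨
        (ρ' ≠ -τ' ∧ ∃ i j : ℤ, |i| + |j| ≤ N + 1 ∧ c + (τ' • barlowOffset (2 : ℝ) - layerNormal layerSpacing) + latPt i j ∈ V ∧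
          IsArrangedIn (kissingShell V (c + (τ' • barlowOffset (2 : ℝ) - layerNormal layerSpacing) + latPt i j)) hcpKissingPattern)) := by
  set c' := c + (τ' • barlowOffset (2 : ℝ) - layerNormal layerSpacing) with hc'
  obtain ⟨ρ', hρ', hD⟩ := layerDisc_down hV hτ' hL hcp
  have hmτ : (-τ' = 1 ∨ -τ' = -1) := by rcases hτ' with rfl | rfl <;> norm_num
  have h00 := hD 0 0 (by simp; linarith)
  rw [latPt_zero, add_zero] at h00
  obtain ⟨hc'V, hSc'⟩ := h00
  refine ⟨ρ', hρ', ?_⟩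
  by_cases htype : ρ' = -τ'
  · left
    have hS' : kissingShell V c' = layerShell ρ' ρ' := by rw [hSc', htype]
    have h := layerDisc_hcp_local hV hc'V hρ' hS' N harr
    rw [← htype]
    exact h
  · by_cases hw : ∃ i j : ℤ, |i| + |j| ≤ N + 1 ∧ c' + latPt i j ∈ V ∧ IsArrangedIn (kissingShell V (c' + latPt i j)) hcpKissingPattern
    · exact Or.inr ⟨htype, hw⟩
    · left
      push Not at hw
      refine layerDisc_fcc_local hV hc'V hmτ hρ' hSc' N fun i j hij hm => ?_
      rcases harr i j hij hm with h | h
      · exact h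
      · exact absurd h (hw i j hij hm)

end Summit.Ventures.Crystal3D.Theorems.LocalStacking

end
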